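import Mathlib
import Summits.QuantumAdvantage.QuantumAdvantage.Theorems.LivenessSeparationLawL

set_option linter.dupNamespace false

/-!
# Liveness separation — part Q (lens 4 «minimal counterexample», g28): `(★)` is NECESSARY — the exact designability criterion

Cell `decomp-qadv`, seat lens-4, generation 28, RESIDUAL MODE beneath `Theses.AbsorptionDial.NoPerfectPolyOdd`
(stmt-QuantumAdvantage-28487); no ledger items. Continues part P (`LivenessSeparationLawL`: every residue pattern `R`
satisfying the single congruence `(★)` is realised exactly by a gap design).

This part proves the CONVERSE and packages the «iff» (memo `S-PRIME.md` §1, §9 (α) of the cell record):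
* `endResidue_identity` — for EVERY input `u` and cuts `g₀ ≤ g_T ≤ n`:
  `2·r(g₀) + 2·r(g_T) ≡ c + 2 g₀ + 2 g_T + 2·#{ones before g₀} + #{ones at or after g_T}  (mod 3)`,
  where `r(g) = c + g + walkExp u g` is the walk residue at the cut `g`;
* `pattern_necessary` — hence the residues realised by ANY input at two cuts `g₀ ≤ g_T` satisfy `(★)` with admissible
  `x₀ ≤ min (2, g₀)`, `xl ≤ min (2, n - g_T)`;
* `residuePattern_iff`, `livePattern_iff` — a residue pattern / a live set on a 2-separated chain is realised by some input
  IFF `(★)` is solvable (sufficiency = part P's `walk_residue_gapPattern` / `livenessPattern`);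
* `isolate_first_iff`, `isolate_last_iff` — part P's hypothesis for isolating an END cut alone is SHARP;
  `isolate_middle_iff` — the EXACT rule for a middle cut alone (`(E + 2 x₀ + xl) % 3 = 0` solvable with admissible
  `x₀, xl`, `E = c + 2 g₀ + 2 g_{T-1}`), sharpening part P's sufficient condition `isolate_middle`;
* `isolate_any` — the «EVERY CUT ALONE» schedule: under end capacity, or `E ≡ 0` with one free end position, every cut of
  the chain is isolable alone (hypothesis (α) of the visible-regime corollary S″).
Brute-force cross-checks of the criterion: cell data `isolable.py` / `isolable2.py` (n ≤ 9) and the critic's run (n ≤ 13).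
-/

namespace Summit.QuantumAdvantage.QuantumAdvantage.Theorems.LivenessSeparation

open Finset Summit.QuantumAdvantage.AdviceFreeQNC0 Summit.QuantumAdvantage.QuantumAdvantage.Theorems.InnerDegreeDial

variable {n : ℕ}

/-! ### the end-cut identity and the necessity of `(★)` -/

section Necessity

/-- THE END-CUT IDENTITY: for every input `u` and cuts `g0 ≤ gT ≤ n`, twice the sum of the two walk residues is, mod 3,
`c + 2 g0 + 2 gT + 2·(ones before g0) + (ones at or after gT)` — the ones strictly between the two cuts cancel. -/
theorem endResidue_identity (c : ℕ) (u : Fin n → Bool) {g0 gT : ℕ} (h0T : g0 ≤ gT) (hT : gT ≤ n) :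
    (2 * (c + g0 + walkExp u g0) + 2 * (c + gT + walkExp u gT)) % 3 =
      (c + 2 * g0 + 2 * gT + 2 * wtPrefix u g0 +
        (univ.filter fun i : Fin n => gT ≤ i.val ∧ i.val < n ∧ u i = true).card) % 3 := by
  have h1 := walkExp_eq_add_card u h0T
  have h2 := walkExp_eq_add_card u hT
  have h3 : walkExp u n = 2 * wt u := by
    unfold walkExp
    rw [ConstBells.wtPrefix_self]
    ring
  have h4 : walkExp u g0 = wt u + wtPrefix u g0 := rfl
  omega

/-- NECESSITY OF `(★)`: the residues `r₀ = (c + g0 + walkExp u g0) % 3`, `r_T = (c + gT + walkExp u gT) % 3` realised by ANY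
input at two cuts `g0 ≤ gT ≤ n` satisfy part P's congruence `(★)` — `c + 2 x₀ + xl + 2 g0 + 2 gT + r_T + 2 (3 - r₀) ≡ 0 (mod 3)` —
with ADMISSIBLE `x₀ ≤ min (2, g0)` (ones before `g0`, mod 3) and `xl ≤ min (2, n - gT)` (ones at or after `gT`, mod 3). -/
theorem pattern_necessary (c : ℕ) (u : Fin n → Bool) {g0 gT : ℕ} (h0T : g0 ≤ gT) (hT : gT ≤ n) :
    ∃ x₀ xl : ℕ, x₀ ≤ 2 ∧ x₀ ≤ g0 ∧ xl ≤ 2 ∧ gT + xl ≤ n ∧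
      (c + 2 * x₀ + xl + 2 * g0 + 2 * gT + (c + gT + walkExp u gT) % 3 +
        2 * (3 - (c + g0 + walkExp u g0) % 3)) % 3 = 0 := by
  have hid := endResidue_identity c u h0T hT
  have hB : wtPrefix u g0 ≤ g0 := by
    unfold wtPrefix
    calc (univ.filter fun i : Fin n => i.val < g0 ∧ u i = true).card
        ≤ (univ.filter fun t : Fin n => 0 ≤ t.val ∧ t.val < g0).card :=
          card_le_card fun t ht => by
            simp only [mem_filter, mem_univ, true_and] at ht ⊢
            exact ⟨Nat.zero_le _, ht.1⟩
      _ = g0 - 0 := JLinPeel.SegMove.card_window (by omega)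
      _ = g0 := by omega
  have hA : (univ.filter fun i : Fin n => gT ≤ i.val ∧ i.val < n ∧ u i = true).card ≤ n - gT := by
    calc (univ.filter fun i : Fin n => gT ≤ i.val ∧ i.val < n ∧ u i = true).card
        ≤ (univ.filter fun t : Fin n => gT ≤ t.val ∧ t.val < n).card :=
          card_le_card fun t ht => by
            simp only [mem_filter, mem_univ, true_and] at ht ⊢
            exact ⟨ht.1, ht.2.1⟩
      _ = n - gT := JLinPeel.SegMove.card_window le_rfl
  refine ⟨wtPrefix u g0 % 3, (univ.filter fun i : Fin n => gT ≤ i.val ∧ i.val < n ∧ u i = true).card % 3,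
    Nat.le_of_lt_succ (Nat.mod_lt _ (by omega)), le_trans (Nat.mod_le _ _) hB,
    Nat.le_of_lt_succ (Nat.mod_lt _ (by omega)), ?_, ?_⟩
  · have := Nat.mod_le ((univ.filter fun i : Fin n => gT ≤ i.val ∧ i.val < n ∧ u i = true).card) 3
    omega
  · omega

end Necessity

/-! ### the exact designability criterion on a 2-separated chain -/

section Criterion

variable {T : ℕ} {g : ℕ → ℕ}

/-- RESIDUE PATTERNS: on a 2-separated chain `g 0 < … < g (T-1) ≤ n`, a residue pattern `R` (values `≤ 2`) is realised by some
input — `(c + g l + walkExp u (g l)) % 3 = R l` for every `l < T` — IFF `(★)` is solvable with admissible `x₀, xl`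
(→ : `pattern_necessary` at the two end cuts; ← : part P's gap design `walk_residue_gapPattern`). -/
theorem residuePattern_iff (hsep : ∀ j, j + 1 < T → g j + 2 ≤ g (j + 1)) (hT : 1 ≤ T) (hgn : g (T - 1) ≤ n) (c : ℕ)
    {R : ℕ → ℕ} (hR : ∀ j, R j ≤ 2) :
    (∃ u : Fin n → Bool, ∀ l < T, (c + g l + walkExp u (g l)) % 3 = R l % 3) ↔
      ∃ x₀ xl : ℕ, x₀ ≤ g 0 ∧ xl ≤ 2 ∧ g (T - 1) + xl ≤ n ∧
        (c + 2 * x₀ + xl + 2 * g 0 + 2 * g (T - 1) + R (T - 1) + 2 * (3 - R 0)) % 3 = 0 := by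
  constructor
  · rintro ⟨u, hu⟩
    obtain ⟨x₀, xl, -, hx0, hxl, hxn, hst⟩ :=
      pattern_necessary c u (le_of_sep hsep (Nat.zero_le _) (show T - 1 < T by omega)) hgn
    refine ⟨x₀, xl, hx0, hxl, hxn, ?_⟩
    have r0 := hu 0 (by omega)
    have rT := hu (T - 1) (by omega)
    have b0 := hR 0
    have bT := hR (T - 1)
    omega
  · rintro ⟨x₀, xl, hx0, hxl, hxn, hst⟩
    exact ⟨_, fun l hl => walk_residue_gapPattern hsep hT hgn hR hx0 hxl hxn hst hl⟩

/-- LIVE SETS: on a 2-separated chain, a liveness pattern `L` (`L l = true` ⟺ the cut `g l` is to be live) is realised by some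
input IFF some residue pattern `R ≤ 2` with `R l ≠ 0 ⟺ L l` solves `(★)` — the kernel form of «DESIGNABLE ⟺ (★) solvable». -/
theorem livePattern_iff (hsep : ∀ j, j + 1 < T → g j + 2 ≤ g (j + 1)) (hT : 1 ≤ T) (hgn : g (T - 1) ≤ n) (c : ℕ)
    (L : ℕ → Bool) :
    (∃ u : Fin n → Bool, ∀ l < T, ∀ gl : Fin (n + 1), gl.val = g l → liveCut c u gl = L l) ↔
      ∃ R : ℕ → ℕ, (∀ j, R j ≤ 2) ∧ (∀ l < T, (R l ≠ 0 ↔ L l = true)) ∧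
        ∃ x₀ xl : ℕ, x₀ ≤ g 0 ∧ xl ≤ 2 ∧ g (T - 1) + xl ≤ n ∧
          (c + 2 * x₀ + xl + 2 * g 0 + 2 * g (T - 1) + R (T - 1) + 2 * (3 - R 0)) % 3 = 0 := by
  constructor
  · rintro ⟨u, hu⟩
    refine ⟨fun l => (c + g l + walkExp u (g l)) % 3, fun j => Nat.le_of_lt_succ (Nat.mod_lt _ (by omega)),
      fun l hl => ?_, ?_⟩
    · have hgl : g l ≤ n := le_trans (le_of_sep hsep (show l ≤ T - 1 by omega) (show T - 1 < T by omega)) hgn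
      have h := hu l hl ⟨g l, by omega⟩ rfl
      simp only [liveCut] at h
      constructor
      · intro hne
        rw [← h]
        exact decide_eq_true hne
      · intro hL
        rw [hL] at h
        exact of_decide_eq_true h
    · exact (residuePattern_iff hsep hT hgn c (fun j => Nat.le_of_lt_succ (Nat.mod_lt _ (by omega)))).1
        ⟨u, fun l _ => (Nat.mod_mod _ 3).symm⟩
  · rintro ⟨R, hR, hRL, x₀, xl, hx0, hxl, hxn, hst⟩
    obtain ⟨u, hu⟩ := livenessPattern hsep hT hgn hR hx0 hxl hxn hst
    refine ⟨u, fun l hl gl hgl => ?_⟩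
    rw [hu l hl gl hgl]
    cases hLl : L l
    · exact decide_eq_false fun hne => by have := (hRL l hl).1 hne; rw [hLl] at this; exact Bool.false_ne_true this
    · exact decide_eq_true ((hRL l hl).2 hLl)

/-- THE FIRST CUT ALONE — SHARP form of part P's `isolate_first` (`T ≥ 2`): the first cut can be made live with every other cut
dead IFF `1 ≤ g 0 ∨ g (T-1) + 1 ≤ n ∨ c + 2 g 0 + 2 g (T-1) ≢ 0 (mod 3)`. -/
theorem isolate_first_iff (hsep : ∀ j, j + 1 < T → g j + 2 ≤ g (j + 1)) (hT : 2 ≤ T) (hgn : g (T - 1) ≤ n) (c : ℕ) :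
    (∃ u : Fin n → Bool, (∀ gl : Fin (n + 1), gl.val = g 0 → liveCut c u gl = true) ∧
      ∀ l < T, l ≠ 0 → ∀ gl : Fin (n + 1), gl.val = g l → liveCut c u gl = false) ↔
    (1 ≤ g 0 ∨ g (T - 1) + 1 ≤ n ∨ (c + 2 * g 0 + 2 * g (T - 1)) % 3 ≠ 0) := by
  refine ⟨fun ⟨u, hlive, hdead⟩ => ?_, isolate_first hsep hT hgn c⟩
  have hmono := le_of_sep hsep (Nat.zero_le _) (show T - 1 < T by omega)
  obtain ⟨x₀, xl, -, hx0, -, hxn, hst⟩ := pattern_necessary c u hmono hgn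
  have h0 := hlive ⟨g 0, by omega⟩ rfl
  have hl := hdead (T - 1) (by omega) (by omega) ⟨g (T - 1), by omega⟩ rfl
  simp only [liveCut, decide_eq_true_eq, decide_eq_false_iff_not, not_not] at h0 hl
  omega

/-- THE LAST CUT ALONE — SHARP form of part P's `isolate_last` (`T ≥ 2`), same criterion. -/
theorem isolate_last_iff (hsep : ∀ j, j + 1 < T → g j + 2 ≤ g (j + 1)) (hT : 2 ≤ T) (hgn : g (T - 1) ≤ n) (c : ℕ) :
    (∃ u : Fin n → Bool, (∀ gl : Fin (n + 1), gl.val = g (T - 1) → liveCut c u gl = true) ∧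
      ∀ l < T, l ≠ T - 1 → ∀ gl : Fin (n + 1), gl.val = g l → liveCut c u gl = false) ↔
    (1 ≤ g 0 ∨ g (T - 1) + 1 ≤ n ∨ (c + 2 * g 0 + 2 * g (T - 1)) % 3 ≠ 0) := by
  refine ⟨fun ⟨u, hlive, hdead⟩ => ?_, isolate_last hsep hT hgn c⟩
  have hmono := le_of_sep hsep (Nat.zero_le _) (show T - 1 < T by omega)
  obtain ⟨x₀, xl, -, hx0, -, hxn, hst⟩ := pattern_necessary c u hmono hgn
  have hl := hlive ⟨g (T - 1), by omega⟩ rfl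
  have h0 := hdead 0 (by omega) (by omega) ⟨g 0, by omega⟩ rfl
  simp only [liveCut, decide_eq_true_eq, decide_eq_false_iff_not, not_not] at h0 hl
  by_contra hne
  have hx : x₀ = 0 := by omega
  have hy : xl = 0 := by omega
  subst hx hy
  rw [h0] at hst
  have hE : (c + 2 * g 0 + 2 * g (T - 1)) % 3 = 0 := by omega
  have hr : (c + g (T - 1) + walkExp u (g (T - 1))) % 3 < 3 := Nat.mod_lt _ (by omega)
  omega

/-- A MIDDLE CUT ALONE — the EXACT rule (sharpening part P's sufficient `isolate_middle`): for `0 < j < T - 1` the cut `g j` can be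
made live with every other cut of the chain dead IFF `(c + 2 g 0 + 2 g (T-1) + 2 x₀ + xl) % 3 = 0` for some admissible
`x₀ ≤ min (2, g 0)`, `xl ≤ min (2, n - g (T-1))`.  (E.g. `n = 5, c = 2`, cuts `0, 2, 4`: the middle cut is NOT isolable alone.) -/
theorem isolate_middle_iff (hsep : ∀ j, j + 1 < T → g j + 2 ≤ g (j + 1)) (hgn : g (T - 1) ≤ n) (c : ℕ) {j : ℕ}
    (hj0 : 0 < j) (hjT : j + 1 < T) :
    (∃ u : Fin n → Bool, (∀ gl : Fin (n + 1), gl.val = g j → liveCut c u gl = true) ∧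
      ∀ l < T, l ≠ j → ∀ gl : Fin (n + 1), gl.val = g l → liveCut c u gl = false) ↔
    ∃ x₀ xl : ℕ, x₀ ≤ 2 ∧ x₀ ≤ g 0 ∧ xl ≤ 2 ∧ g (T - 1) + xl ≤ n ∧
      (c + 2 * g 0 + 2 * g (T - 1) + 2 * x₀ + xl) % 3 = 0 := by
  have hmono := le_of_sep hsep (Nat.zero_le _) (show T - 1 < T by omega)
  constructor
  · rintro ⟨u, -, hdead⟩
    obtain ⟨x₀, xl, hx2, hx0, hxl, hxn, hst⟩ := pattern_necessary c u hmono hgn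
    have h0 := hdead 0 (by omega) (by omega) ⟨g 0, by omega⟩ rfl
    have hl := hdead (T - 1) (by omega) (by omega) ⟨g (T - 1), by omega⟩ rfl
    simp only [liveCut, decide_eq_false_iff_not, not_not] at h0 hl
    exact ⟨x₀, xl, hx2, hx0, hxl, hxn, by omega⟩
  · rintro ⟨x₀, xl, -, hx0, hxl, hxn, hst⟩
    refine livenessDesign_at hsep (by omega) hgn (j₀ := j) (r := 1) (by omega) (Or.inl rfl) hx0 hxl hxn ?_
    rw [tgt_of_ne 1 (show T - 1 ≠ j by omega), tgt_of_ne 1 (show 0 ≠ j by omega)]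
    omega

/-- THE «EVERY CUT ALONE» SCHEDULE (hypothesis (α) of the visible-regime corollary S″): on a 2-separated chain with `T ≥ 2` cuts,
if there is END CAPACITY — two free positions before the first cut, or two after the last, or one on each side — or
`c + 2 g 0 + 2 g (T-1) ≡ 0 (mod 3)` together with one free end position, then EVERY cut of the chain can be made live with
all the other cuts dead (by part P's `isolate_first` / `isolate_last` / `isolate_middle`). -/
theorem isolate_any (hsep : ∀ j, j + 1 < T → g j + 2 ≤ g (j + 1)) (hT : 2 ≤ T) (hgn : g (T - 1) ≤ n) (c : ℕ)
    (hcap : 2 ≤ g 0 ∨ g (T - 1) + 2 ≤ n ∨ (1 ≤ g 0 ∧ g (T - 1) + 1 ≤ n) ∨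
      ((c + 2 * g 0 + 2 * g (T - 1)) % 3 = 0 ∧ (1 ≤ g 0 ∨ g (T - 1) + 1 ≤ n)))
    {j : ℕ} (hj : j < T) :
    ∃ u : Fin n → Bool, (∀ gl : Fin (n + 1), gl.val = g j → liveCut c u gl = true) ∧
      ∀ l < T, l ≠ j → ∀ gl : Fin (n + 1), gl.val = g l → liveCut c u gl = false := by
  have hends : 1 ≤ g 0 ∨ g (T - 1) + 1 ≤ n ∨ (c + 2 * g 0 + 2 * g (T - 1)) % 3 ≠ 0 := by
    rcases hcap with h | h | ⟨h, -⟩ | ⟨-, h | h⟩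
    · exact Or.inl (by omega)
    · exact Or.inr (Or.inl (by omega))
    · exact Or.inl h
    · exact Or.inl h
    · exact Or.inr (Or.inl h)
  have hmid : (c + 2 * g 0 + 2 * g (T - 1)) % 3 = 0 ∨ 2 ≤ g 0 ∨ g (T - 1) + 2 ≤ n ∨ (1 ≤ g 0 ∧ g (T - 1) + 1 ≤ n) := by
    rcases hcap with h | h | h | ⟨h, -⟩
    · exact Or.inr (Or.inl h)
    · exact Or.inr (Or.inr (Or.inl h))
    · exact Or.inr (Or.inr (Or.inr h))
    · exact Or.inl h
  by_cases hj0 : j = 0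
  · subst hj0
    exact isolate_first hsep hT hgn c hends
  · by_cases hjT : j = T - 1
    · subst hjT
      exact isolate_last hsep hT hgn c hends
    · exact isolate_middle hsep hgn c (by omega) (by omega) hmid

end Criterion

end Summit.QuantumAdvantage.QuantumAdvantage.Theorems.LivenessSeparation
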